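import Summits.AtomisticToContinuum.Crystallization.Theses.BraggSlacknessRigidity
import Summits.AtomisticToContinuum.Crystallization.Theorems.ThreeConeCertificateExactCertificateFieldInvisible

/-!
# Crux `StrictCertificate` (stmt-AtomisticToContinuum-13167, route `BraggSlacknessRigidity`):
# necessary conditions on a witness, II — BRAGG-PEAK VANISHING `S_P(k) · 𝓕F(k) = 0` on the dual lattice

Support file for the line `registered` (lead c3); nothing here closes the item.  For a witness
`⟨P, ρ, c, g, U, f⟩` of the crux with integrable `F = f∘‖·‖` (conjunct 11) we prove that the Fourier
transform of the Bochner kernel vanishes at every vector `k` of the dual lattice of `P.lattice` at which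
the motif's structure factor `S_P(k) = Σ_{x ∈ motif} e^{−2πi⟨x,k⟩}` does not:

  `structureFactor_mul_fourier_eq_zero :  S_P(k) · 𝓕F(k) = 0`   for all `k` with `⟨k, g⟩ ∈ ℤ` (`g ∈ P.lattice`).

This is the Fourier-side reading of complementary slackness for the Bochner cone ("`𝓕f · S_F = 0` on the
reciprocal lattice", route docstring of `ExactCertificate`; `k = 0` is `…Necessary.fourier_zero_eq_zero`),
obtained here WITHOUT Poisson summation: by THE INVISIBILITY THEOREM of the sibling crux
(`Field.field_eq_zero`: the crystal's `f`-field `T(w) = Σ_{y ∈ P} f(|w − y|)` vanishes at every `w`), the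
TWISTED motif-summed translate `Φ_k(v) := e^{−2πi⟨v,k⟩} Σ_{x∈motif} F(v − x)` has vanishing lattice sums
`Σ_{ℓ ∈ G} Φ_k(ℓ + w) = e^{−2πi⟨w,k⟩} T(w) = 0` — the phase FACTORS OUT of the lattice sum exactly because
`⟨k, ℓ⟩ ∈ ℤ` — so its integral vanishes by unfolding over a fundamental domain
(`integral_eq_zero_of_tsum_translate_eq_zero`), while `∫ Φ_k = S_P(k) · 𝓕F(k)` by translating each motif
term.  The registered sub-goal `bragg_vanishing_of_clauses` restates it with the crux's clauses verbatim.

For the hcp template (motif `{b₀, b₁}`, `S(k) = e^{−2πi⟨b₀,k⟩}(1 + e^{−2πi⟨b₁−b₀,k⟩})`) this pins the zeros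
of `𝓕F` on the reciprocal lattice to the NON-EXTINCT Bragg peaks, exactly as conjunct 14 of the crux
anticipates ("`f̂` may vanish on extinct Bragg spheres").  All `[folklore]`.
-/

noncomputable section

namespace Summit.AtomisticToContinuum.Crystallization.Theorems.BraggSlacknessRigidityStrictCertificate

open Literature.MathematicalPhysics.StatisticalMechanics
open Summit.AtomisticToContinuum.Crystallization.Theses.BraggSlacknessRigidity
open Summit.AtomisticToContinuum.Crystallization.Theorems.ExactCertificateNegative (IsSplit)
open Summit.AtomisticToContinuum.Crystallization.Theorems.ChargedEnergyGapNegative (E3)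
open Summit.AtomisticToContinuum.Crystallization.Theorems.ChargedEnergyGapNegative.Blocks
  (zBasis latVec latVecL latVec_neg)
open Summit.AtomisticToContinuum.Crystallization.Theorems.ThreeConeCertificateExactCertificate.Slackness
  (f_zero_add_two_mul_energyPerParticle_f)
open Summit.AtomisticToContinuum.Crystallization.Theorems.ThreeConeCertificateExactCertificate.Field
  (field_eq_zero summable_coset_of_isSplit periodisation_posType_of_isSplit)
open MeasureTheory
open scoped BigOperators FourierTransform RealInnerProductSpace

/-! ## Unfolding over a fundamental domain -/

/-- **Unfolding.** An integrable `Φ : ℝ³ → ℂ` all of whose lattice sums of translates vanish,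
`Σ_{ℓ ∈ G} Φ(ℓ + w) = 0` for every `w`, has `∫ Φ = 0`: `∫ Φ = Σ'_ℓ ∫_D Φ(ℓ + w) dw = ∫_D Σ'_ℓ Φ(ℓ + w) dw`
for a fundamental domain `D` of the lattice of periods (Mathlib `ZLattice.isAddFundamentalDomain`,
`IsAddFundamentalDomain.integral_eq_tsum''`, `integral_tsum`). [folklore] -/
theorem integral_eq_zero_of_tsum_translate_eq_zero (P : PeriodicConfiguration 3) {Φ : E3 → ℂ}
    (hΦ : Integrable Φ) (hzero : ∀ w : E3, ∑' g : P.lattice, Φ ((g : E3) + w) = 0) :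
    ∫ v, Φ v = 0 := by
  haveI : MeasurableVAdd P.lattice E3 := (inferInstance : MeasurableVAdd P.lattice.toAddSubgroup E3)
  haveI : VAddInvariantMeasure P.lattice E3 volume :=
    (inferInstance : VAddInvariantMeasure P.lattice.toAddSubgroup E3 volume)
  have hD : IsAddFundamentalDomain P.lattice (ZSpan.fundamentalDomain ((zBasis P).ofZLatticeBasis ℝ))
      (volume : Measure E3) :=
    ZLattice.isAddFundamentalDomain (zBasis P) volume
  have hvadd : ∀ (g : P.lattice) (w : E3), g +ᵥ w = (g : E3) + w := fun _ _ => rfl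
  have hmeas : ∀ g : P.lattice, AEStronglyMeasurable (fun w : E3 => Φ (g +ᵥ w))
      ((volume : Measure E3).restrict (ZSpan.fundamentalDomain ((zBasis P).ofZLatticeBasis ℝ))) :=
    fun g => ((hΦ.comp_add_left (g : E3)).aestronglyMeasurable).restrict
  have hfin : ∑' g : P.lattice, ∫⁻ w in ZSpan.fundamentalDomain ((zBasis P).ofZLatticeBasis ℝ),
      ‖Φ (g +ᵥ w)‖ₑ ≠ ⊤ := by
    rw [← hD.lintegral_eq_tsum'' fun v => ‖Φ v‖ₑ]
    exact hΦ.2.ne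
  rw [hD.integral_eq_tsum'' Φ hΦ, ← integral_tsum hmeas hfin]
  simp only [hvadd, hzero, integral_zero]

/-! ## The periodisation of a witness kernel vanishes, lattice-indexed form -/

/-- **Lattice-indexed periodisation.** If the coset sums `Σ_d φ(v − latVec d)` converge and
`Σ_{x∈F} Σ_d φ(w − x − latVec d) = 0` for all `w`, then, indexing by the lattice itself, every
`ℓ ↦ φ(ℓ + w − x)` is summable and `Σ'_{ℓ ∈ G} Σ_{x ∈ F} φ(ℓ + w − x) = 0`. [folklore] -/
theorem tsum_lattice_sum_motif_eq_zero (P : PeriodicConfiguration 3) {φ : E3 → ℝ}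
    (hs : ∀ v : E3, Summable fun d : Fin 3 → ℤ => φ (v - latVec P d))
    (hzero : ∀ w : E3, ∑ x ∈ P.motif, ∑' d : Fin 3 → ℤ, φ (w - x - latVec P d) = 0) (w : E3) :
    (∀ x : E3, Summable fun g : P.lattice => φ ((g : E3) + w - x)) ∧
      ∑' g : P.lattice, ∑ x ∈ P.motif, φ ((g : E3) + w - x) = 0 := by
  -- adapted from …Necessary.integral_eq_zero_of_periodisation_eq_zero (same seat)
  set e : (Fin 3 → ℤ) ≃ P.lattice := (zBasis P).equivFun.symm.toEquiv with hedef
  have he : ∀ d, ((e d : P.lattice) : E3) = latVec P d := fun d => rfl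
  have hpt : ∀ (x : E3) (d : Fin 3 → ℤ), latVec P d + w - x = w - x - latVec P (-d) := by
    intro x d
    rw [latVec_neg, sub_neg_eq_add]
    abel
  have hsx : ∀ x : E3, Summable fun g : P.lattice => φ ((g : E3) + w - x) := by
    intro x
    refine (e.summable_iff).1 ?_
    have h' : Summable fun d : Fin 3 → ℤ => φ (w - x - latVec P (-d)) :=
      (Equiv.neg (Fin 3 → ℤ)).summable_iff.2 (hs (w - x))
    refine h'.congr fun d => ?_
    show φ (w - x - latVec P (-d)) = φ ((e d : E3) + w - x)
    rw [he, hpt]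
  refine ⟨hsx, ?_⟩
  rw [Summable.tsum_finsetSum (fun x _ => hsx x), ← hzero w]
  refine Finset.sum_congr rfl fun x _ => ?_
  calc ∑' g : P.lattice, φ ((g : E3) + w - x)
      = ∑' d : Fin 3 → ℤ, φ ((e d : E3) + w - x) :=
        (e.tsum_eq fun g : P.lattice => φ ((g : E3) + w - x)).symm
    _ = ∑' d : Fin 3 → ℤ, φ (w - x - latVec P (-d)) := tsum_congr fun d => by rw [he, hpt]
    _ = ∑' d : Fin 3 → ℤ, φ (w - x - latVec P d) :=
        (Equiv.neg (Fin 3 → ℤ)).tsum_eq fun d => φ (w - x - latVec P d)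

/-- **For a witness, `Σ'_{ℓ ∈ G} Σ_{x ∈ F} f(‖ℓ + w − x‖) = 0` at every `w`** (invisibility theorem
`Field.field_eq_zero`, re-indexed by the lattice). [folklore] -/
theorem tsum_lattice_field_eq_zero {P : PeriodicConfiguration 3} {ρ c : ℝ} {g U f : ℝ → ℝ}
    (hs : IsSplit ρ c g U f) (hv : c + f 0 / 2 ≤ -(P.energyPerParticle lennardJones)) (w : E3) :
    (∀ x : E3, Summable fun l : P.lattice => f ‖(l : E3) + w - x‖) ∧
      ∑' l : P.lattice, ∑ x ∈ P.motif, f ‖(l : E3) + w - x‖ = 0 := by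
  have hsum := summable_coset_of_isSplit P hs
  have hz : ∀ w : E3, ∑ x ∈ P.motif, ∑' d : Fin 3 → ℤ, f (dist (w - x) (latVec P d)) = 0 :=
    fun w => field_eq_zero P f hsum (periodisation_posType_of_isSplit P hs)
      (f_zero_add_two_mul_energyPerParticle_f hs hv) w
  refine tsum_lattice_sum_motif_eq_zero P (φ := fun v => f ‖v‖) (fun v => ?_) (fun w => ?_) w
  · simpa only [dist_eq_norm] using hsum v
  · simpa only [dist_eq_norm] using hz w

/-! ## Bragg-peak vanishing -/

/-- **BRAGG-PEAK VANISHING: `S_P(k) · 𝓕F(k) = 0` for every dual-lattice vector `k`.**  For a witness with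
integrable `F = f∘‖·‖` and every `k` with `⟨k, g⟩ ∈ ℤ` for all periods `g`:
`(Σ_{x ∈ motif} e^{−2πi⟨x,k⟩}) · 𝓕F(k) = 0`.  Proof: the twisted motif-summed translate
`Φ(v) = e^{−2πi⟨v,k⟩} Σ_x F(v − x)` is integrable, its lattice sums are `e^{−2πi⟨w,k⟩} · T(w) = 0`
(`tsum_lattice_field_eq_zero`; the character is `G`-periodic since `k` is dual), so `∫ Φ = 0`
(`integral_eq_zero_of_tsum_translate_eq_zero`); and `∫ Φ = S_P(k) · 𝓕F(k)` by translating each term.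
[folklore] -/
theorem structureFactor_mul_fourier_eq_zero {P : PeriodicConfiguration 3} {ρ c : ℝ} {g U f : ℝ → ℝ}
    (hs : IsSplit ρ c g U f) (hv : c + f 0 / 2 ≤ -(P.energyPerParticle lennardJones))
    (hFi : Integrable fun v : E3 => (f ‖v‖ : ℂ)) {k : E3}
    (hk : ∀ g ∈ P.lattice, ∃ n : ℤ, ⟪k, g⟫ = (n : ℝ)) :
    (∑ x ∈ P.motif, Complex.exp (↑(-2 * Real.pi * ⟪x, k⟫) * Complex.I)) *
      𝓕 (fun v : E3 => (f ‖v‖ : ℂ)) k = 0 := by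
  set F : E3 → ℂ := fun v => (f ‖v‖ : ℂ) with hFdef
  set χ : E3 → ℂ := fun v => Complex.exp (↑(-2 * Real.pi * ⟪v, k⟫) * Complex.I) with hχdef
  set Φ : E3 → ℂ := fun v => χ v * ∑ x ∈ P.motif, F (v - x) with hΦdef
  have hχ_norm : ∀ v, ‖χ v‖ = 1 := fun v => Complex.norm_exp_ofReal_mul_I _
  have hχ_cont : Continuous χ := by
    rw [hχdef]
    fun_prop
  have hχ_meas : AEStronglyMeasurable χ (volume : Measure E3) := hχ_cont.aestronglyMeasurable
  -- the character is periodic along the lattice (k is a dual vector)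
  have hχ_per : ∀ (l : P.lattice) (w : E3), χ ((l : E3) + w) = χ w := by
    intro l w
    obtain ⟨n, hn⟩ := hk l l.2
    show Complex.exp (↑(-2 * Real.pi * ⟪(l : E3) + w, k⟫) * Complex.I) =
      Complex.exp (↑(-2 * Real.pi * ⟪w, k⟫) * Complex.I)
    rw [inner_add_left, real_inner_comm k (l : E3), hn]
    rw [show ((-2 * Real.pi * ((n : ℝ) + ⟪w, k⟫) : ℝ) : ℂ) * Complex.I =
        ↑(-2 * Real.pi * ⟪w, k⟫) * Complex.I + ((-n : ℤ) : ℂ) * (2 * Real.pi * Complex.I) by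
      push_cast; ring]
    rw [Complex.exp_add, Complex.exp_int_mul_two_pi_mul_I, mul_one]
  -- translating the character
  have hχ_add : ∀ v x : E3, χ (v + x) = χ x * χ v := by
    intro v x
    show Complex.exp (↑(-2 * Real.pi * ⟪v + x, k⟫) * Complex.I) =
      Complex.exp (↑(-2 * Real.pi * ⟪x, k⟫) * Complex.I) * Complex.exp (↑(-2 * Real.pi * ⟪v, k⟫) * Complex.I)
    rw [inner_add_left, ← Complex.exp_add]
    congr 1
    push_cast
    ring
  -- integrability
  have hterm : ∀ x : E3, Integrable fun v => χ v * F (v - x) := fun x =>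
    (hFi.comp_sub_right x).bdd_mul (c := 1) hχ_meas (ae_of_all _ fun v => (hχ_norm v).le)
  have hΦi : Integrable Φ :=
    (integrable_finsetSum _ fun x _ => hFi.comp_sub_right x).bdd_mul (c := 1) hχ_meas
      (ae_of_all _ fun v => (hχ_norm v).le)
  -- the lattice sums of Φ vanish
  have hzero : ∀ w : E3, ∑' l : P.lattice, Φ ((l : E3) + w) = 0 := by
    intro w
    obtain ⟨-, hT⟩ := tsum_lattice_field_eq_zero hs hv w
    have hT' : ∑' l : P.lattice, ∑ x ∈ P.motif, F ((l : E3) + w - x) = 0 := by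
      have h := congrArg (fun r : ℝ => (r : ℂ)) hT
      simp only [Complex.ofReal_zero, Complex.ofReal_tsum, Complex.ofReal_sum] at h
      exact h
    calc ∑' l : P.lattice, Φ ((l : E3) + w)
        = ∑' l : P.lattice, χ w * ∑ x ∈ P.motif, F ((l : E3) + w - x) :=
          tsum_congr fun l => by
            show χ ((l : E3) + w) * ∑ x ∈ P.motif, F ((l : E3) + w - x) = _
            rw [hχ_per]
      _ = χ w * ∑' l : P.lattice, ∑ x ∈ P.motif, F ((l : E3) + w - x) := tsum_mul_left
      _ = 0 := by rw [hT', mul_zero]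
  -- ∫ Φ = S(k) · 𝓕F(k)
  have hone : ∀ x : E3, ∫ v, χ v * F (v - x) =
      Complex.exp (↑(-2 * Real.pi * ⟪x, k⟫) * Complex.I) * 𝓕 F k := by
    intro x
    have hshift : ∫ v, χ v * F (v - x) = ∫ v, χ (v + x) * F v := by
      rw [← integral_add_right_eq_self (fun v => χ v * F (v - x)) x]
      simp only [add_sub_cancel_right]
    have hpt : ∀ v, χ (v + x) * F v = χ x * (χ v * F v) := fun v => by rw [hχ_add, mul_assoc]
    rw [hshift]
    simp_rw [hpt]
    rw [integral_const_mul, Real.fourier_eq']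
    simp only [hχdef, smul_eq_mul]
  have hint : ∫ v, Φ v =
      (∑ x ∈ P.motif, Complex.exp (↑(-2 * Real.pi * ⟪x, k⟫) * Complex.I)) * 𝓕 F k := by
    calc ∫ v, Φ v = ∫ v, ∑ x ∈ P.motif, χ v * F (v - x) := by
            refine integral_congr_ae (ae_of_all _ fun v => ?_)
            show χ v * ∑ x ∈ P.motif, F (v - x) = ∑ x ∈ P.motif, χ v * F (v - x)
            rw [Finset.mul_sum]
      _ = ∑ x ∈ P.motif, ∫ v, χ v * F (v - x) := integral_finsetSum _ fun x _ => hterm x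
      _ = ∑ x ∈ P.motif, Complex.exp (↑(-2 * Real.pi * ⟪x, k⟫) * Complex.I) * 𝓕 F k :=
            Finset.sum_congr rfl fun x _ => hone x
      _ = (∑ x ∈ P.motif, Complex.exp (↑(-2 * Real.pi * ⟪x, k⟫) * Complex.I)) * 𝓕 F k := by
            rw [Finset.sum_mul]
  rw [← hint]
  exact integral_eq_zero_of_tsum_translate_eq_zero P hΦi hzero

/-! ## Total Fourier mass of the Bochner kernel -/

/-- **`∫ 𝓕F = f 0`** for a radial kernel with the regularity conjuncts 10–12 of the crux (Fourier
inversion `Continuous.fourierInv_fourier_eq` evaluated at the origin). [folklore] -/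
theorem integral_fourier_eq_f_zero (f : ℝ → ℝ)
    (hFc : Continuous fun v : E3 => (f ‖v‖ : ℂ))
    (hFi : Integrable fun v : E3 => (f ‖v‖ : ℂ))
    (hFF : Integrable (𝓕 fun v : E3 => (f ‖v‖ : ℂ))) :
    ∫ ξ, 𝓕 (fun v : E3 => (f ‖v‖ : ℂ)) ξ = (f 0 : ℂ) := by
  have hinv := hFc.fourierInv_fourier_eq hFi hFF
  have h0 := congrFun hinv 0
  rw [Real.fourierInv_eq'] at h0
  simpa using h0

/-- **The total Fourier mass of a witness kernel is at most twice the modulus of the template energy**: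
with conjuncts 10–12, `Re ∫ 𝓕F = f 0 = −2(c + e_LJ(P)) ≤ −2 e_LJ(P)` (`c ≥ 0`, `IsSplit.c_nonneg`).  With
conjunct 13 the integrand is pointwise `≥ 0`, so this bounds `‖𝓕F‖_{L¹}`. [folklore] -/
theorem re_integral_fourier_le {P : PeriodicConfiguration 3} {ρ c : ℝ} {g U f : ℝ → ℝ}
    (hs : IsSplit ρ c g U f) (hv : c + f 0 / 2 ≤ -(P.energyPerParticle lennardJones))
    (hFc : Continuous fun v : E3 => (f ‖v‖ : ℂ))
    (hFi : Integrable fun v : E3 => (f ‖v‖ : ℂ))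
    (hFF : Integrable (𝓕 fun v : E3 => (f ‖v‖ : ℂ))) :
    (∫ ξ, 𝓕 (fun v : E3 => (f ‖v‖ : ℂ)) ξ).re ≤ -2 * P.energyPerParticle lennardJones := by
  rw [integral_fourier_eq_f_zero f hFc hFi hFF, Complex.ofReal_re]
  linarith [hs.c_nonneg]

/-- **Registered sub-goal `bragg_vanishing_of_clauses`** (crux conjuncts 2–7 and 11 verbatim as hypotheses):
Bragg-peak vanishing `S_P(k) · 𝓕F(k) = 0` on the dual lattice, for every witness of `StrictCertificate`
(indeed of `ExactCertificate` with integrable `F`). [folklore] -/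
theorem bragg_vanishing_of_clauses : ∀ (P : Literature.MathematicalPhysics.StatisticalMechanics.PeriodicConfiguration 3) (ρ c : ℝ) (g U f : ℝ → ℝ), (∀ r : ℝ, 0 < r → Literature.MathematicalPhysics.StatisticalMechanics.lennardJones r = g r + U r + f r) → (∀ r : ℝ, 0 < r → 0 ≤ U r) → (∀ r : ℝ, ρ ≤ r → g r = 0) → (∀ (n : ℕ) (y : Fin n → EuclideanSpace ℝ (Fin 3)) (w : Fin n → ℝ), 0 ≤ ∑ i, ∑ j, w i * w j * f (dist (y i) (y j))) → (∀ (N : ℕ) (x : Fin N → EuclideanSpace ℝ (Fin 3)), Function.Injective x → -(c * (N : ℝ)) ≤ Literature.MathematicalPhysics.StatisticalMechanics.interactionEnergy g x) → c + f 0 / 2 = -(P.energyPerParticle Literature.MathematicalPhysics.StatisticalMechanics.lennardJones) → MeasureTheory.Integrable (fun v : EuclideanSpace ℝ (Fin 3) => (f ‖v‖ : ℂ)) → ∀ k : EuclideanSpace ℝ (Fin 3), (∀ g ∈ P.lattice, ∃ n : ℤ, inner ℝ k g = (n : ℝ)) → (∑ x ∈ P.motif, Complex.exp (↑(-2 * Real.pi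 * inner ℝ x k) * Complex.I)) * FourierTransform.fourier (fun v : EuclideanSpace ℝ (Fin 3) => (f ‖v‖ : ℂ)) k = 0 :=
  fun _P _ρ _c _g _U _f h1 h2 h3 h4 h5 h6 hFi _k hk =>
    structureFactor_mul_fourier_eq_zero ⟨h1, h2, h3, h4, h5⟩ h6.le hFi hk

end Summit.AtomisticToContinuum.Crystallization.Theorems.BraggSlacknessRigidityStrictCertificate

end
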